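import Summits.AtomisticToContinuum.HydrodynamicLimit.Theses.TwoTimePressureGerm
import Summits.AtomisticToContinuum.HydrodynamicLimit.Theorems.RelayRaceLocalityRestartPrincipleOfMeanHL

/-!
# Restates-summit probe `S → C` for the crux `MeanEulerLimit` (stmt-AtomisticToContinuum-17727)

`_root_.HydrodynamicLimit → TwoTimePressureGerm.MeanEulerLimit`: the (packing-guarded) sub-problem conjunct
implies the crux (the crux is NECESSARY). Witnesses `η₀ := η₀`, `σ₀ := min σ₀ (1/2)`; inside the frame the
conjunct's convergence in probability at time `t` is upgraded to convergence of the expectations by the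
in-tree uniform-integrability theorem `RestartPrinciple.tendsto_means_flow_of_tendstoHydroFieldsAt_of_solution`
(density: bounded convergence; momentum coordinates and energy: uniform second moments from energy conservation
along the flow + Gaussian statics). The only new step is the VECTOR form of the momentum limit: the time-`t`
momentum field is Bochner-integrable under the local Gibbs law (norm bounded by `C/2 · (1 + (N+1)⁻¹∑‖vᵢ(t)‖²)`,
the mean squared speed being conserved a.s. and of bounded expectation at `t = 0`), so its Bochner integral has
the coordinate integrals as coordinates, and convergence in `ℝ³` is coordinatewise.

`C → S` ALSO HOLDS modulo LANDED theorems: `MeanEulerLimit → ResponseRigidity.MeanHydroLimitInBand` (smooth `χ` are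
continuous; coordinates of the vector limit) and the tree's `RestartPrinciple.hydrodynamicLimit_of_meanHydroLimitInBand`
(mean ⇒ probability by entropy saturation, `MeanClosure` stmt-11929 proved, p128739). Hence
`meanEulerLimit_iff_hydrodynamicLimit : MeanEulerLimit ↔ HydrodynamicLimit` — the rank-4 crux IS the sub-problem conjunct
modulo landed glue (restates-summit), and `TiltSubGaussian` is idle in the route's `closes`.
-/

noncomputable section

namespace Summit.AtomisticToContinuum.HydrodynamicLimit.Cruxes.MeanEulerLimit.Vetting

open scoped BigOperators ENNReal Topology
open MeasureTheory Set Filter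
open Literature.MathematicalPhysics.KineticTheory Literature.Analysis.FluidPDE Literature.Analysis.FunctionSpaces
open Summit.AtomisticToContinuum.HydrodynamicLimit.Theses
open Summit.AtomisticToContinuum.HydrodynamicLimit.Theorems.NearConstantShortTimeHL
open Summit.AtomisticToContinuum.HydrodynamicLimit.Theorems.AmplitudeTransfer (integral_apply_V3)
open Summit.AtomisticToContinuum.HydrodynamicLimit.Theorems.RestartPrinciple
  (tendsto_means_flow_of_tendstoHydroFieldsAt_of_solution)

/-- Measurability of the empirical momentum field tested against a continuous `χ`. -/
theorem measurable_empiricalMomentumField' {N : ℕ} {χ : T3 → ℝ} (hχ : Continuous χ) :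
    Measurable fun z : Config N (Fin 3) T3 => empiricalMomentumField z χ := by
  have hpos : ∀ i : Fin N, Measurable fun z : Config N (Fin 3) T3 => (z i).1 :=
    fun i => (measurable_pi_apply i).fst
  have hvel : ∀ i : Fin N, Measurable fun z : Config N (Fin 3) T3 => (z i).2 :=
    fun i => (measurable_pi_apply i).snd
  simp_rw [empiricalMomentumField_eq_sum]
  exact (Finset.measurable_sum _ fun i _ =>
    (hχ.measurable.comp (hpos i)).smul (hvel i)).const_smul ((N : ℝ)⁻¹)

/-- In `ℝ³`, convergence follows from convergence of the three coordinates. -/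
theorem tendsto_V3_of_coord {f : ℕ → V3} {a : V3}
    (h : ∀ j : Fin 3, Tendsto (fun N => f N j) atTop (𝓝 (a j))) : Tendsto f atTop (𝓝 a) := by
  have e := (EuclideanSpace.equiv (Fin 3) ℝ)
  have h1 : Tendsto (fun N => (EuclideanSpace.equiv (Fin 3) ℝ) (f N)) atTop
      (𝓝 ((EuclideanSpace.equiv (Fin 3) ℝ) a)) := by
    rw [tendsto_pi_nhds]
    intro j
    simpa using h j
  have h2 := ((EuclideanSpace.equiv (Fin 3) ℝ).symm.continuous.tendsto _).comp h1
  simpa [Function.comp_def] using h2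

/-- **The time-`t` empirical momentum field is Bochner-integrable under the local Gibbs law** (continuous
profiles, `σ ≤ 1/2`, continuous `χ`): `‖m[χ]‖² ≤ C² · (N+1)⁻¹∑‖vᵢ(t)‖²`, the mean squared speed is conserved
a.s. along the flow and has expectation `≤ 3 sup θ₀ + sup‖u₀‖²` at `t = 0`. -/
theorem integrable_momentumField_flow {σ : ℝ} {a₀ θ₀ : T3 → ℝ} {u₀ : T3 → V3}
    (ha : Continuous a₀) (hθ : Continuous θ₀) (hu : Continuous u₀) (ha0 : ∀ x, 0 < a₀ x) (hθ0 : ∀ x, 0 < θ₀ x)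
    (hσ2 : σ ≤ 1 / 2) (N : ℕ) (Φ : HardSphereFlow (Torus.geometry (Fin 3)) (hsDiameter σ N) (N + 1))
    (t : ℝ) {χ : T3 → ℝ} (hχ : Continuous χ) :
    Integrable (fun z => empiricalMomentumField (Φ.flow t z) χ) (localGibbsLaw σ a₀ u₀ θ₀ N Φ) := by
  set P : Measure (Config (N + 1) (Fin 3) T3) := localGibbsLaw σ a₀ u₀ θ₀ N Φ with hPdef
  haveI hPI : IsProbabilityMeasure P := isProbabilityMeasure_localGibbsLaw ha hθ hu ha0 hθ0 hσ2 N Φ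
  haveI hPI' : IsProbabilityMeasure (particleLaw Φ
      (canonicalDensity (Torus.geometry (Fin 3)) (hsDiameter σ N) (N + 1) (localGibbsProfile a₀ u₀ θ₀))) := hPI
  have hPac : P ≪ liouville (Torus.geometry (Fin 3)) (N + 1) (hsDiameter σ N) :=
    particleLaw_absolutelyContinuous Φ _
  obtain ⟨Θ, hΘ0, hΘ⟩ := exists_forall_abs_le_of_continuous hθ
  obtain ⟨U, hU0, hU⟩ := exists_forall_abs_le_of_continuous (continuous_norm.comp hu)
  have hΘ' : ∀ x, θ₀ x ≤ Θ := fun x => (le_abs_self _).trans (hΘ x)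
  have hU' : ∀ x, ‖u₀ x‖ ≤ U := fun x => (le_abs_self _).trans (hU x)
  obtain ⟨Cχ, hCχ0, hCχ⟩ := exists_forall_abs_le_of_continuous hχ
  set B₁ : ℝ := 3 * Θ + U ^ 2 with hB₁def
  have hB₁ : ∀ x, 3 * θ₀ x + ‖u₀ x‖ ^ 2 ≤ B₁ := fun x => by
    have h1 : θ₀ x ≤ Θ := hΘ' x
    have h2 : ‖u₀ x‖ ^ 2 ≤ U ^ 2 := pow_le_pow_left₀ (norm_nonneg _) (hU' x) 2
    rw [hB₁def]
    linarith
  -- the mean squared speed at time `t`: measurable, a.s. equal to its value at time `0`, finite expectation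
  set g : Config (N + 1) (Fin 3) T3 → ℝ := fun z => (((N + 1 : ℕ)) : ℝ)⁻¹ * ∑ i, ‖(Φ.flow t z i).2‖ ^ 2
    with hgdef
  have hgm : Measurable g := by
    refine measurable_const.mul (Finset.measurable_sum _ fun i _ => ?_)
    exact ((measurable_pi_apply i).snd.comp (Φ.measurable_flow t)).norm.pow_const 2
  have hg0 : ∀ z, 0 ≤ g z := fun z => by positivity
  have hV0 : ∫⁻ z, ENNReal.ofReal ((((N + 1 : ℕ)) : ℝ)⁻¹ * ∑ i, ‖(z i).2‖ ^ 2) ∂P ≤ ENNReal.ofReal B₁ :=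
    lintegral_avg_norm_sq_vel_le Φ ha hθ hu (fun x => (ha0 x).le) hθ0 hB₁
  have hVt : ∫⁻ z, ENNReal.ofReal (g z) ∂P ≤ ENNReal.ofReal B₁ := by
    refine le_trans (le_of_eq (lintegral_congr_ae ?_)) hV0
    filter_upwards [sum_norm_sq_vel_flow_ae Φ hPac t] with z hz
    show ENNReal.ofReal ((((N + 1 : ℕ)) : ℝ)⁻¹ * ∑ i, ‖(Φ.flow t z i).2‖ ^ 2) =
      ENNReal.ofReal ((((N + 1 : ℕ)) : ℝ)⁻¹ * ∑ i, ‖(z i).2‖ ^ 2)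
    rw [show (∑ i, ‖(Φ.flow t z i).2‖ ^ 2) = ∑ i, ‖(z i).2‖ ^ 2 from hz]
  have hgi : Integrable g P := by
    refine ⟨hgm.aestronglyMeasurable, ?_⟩
    rw [hasFiniteIntegral_iff_ofReal (ae_of_all _ hg0)]
    exact hVt.trans_lt ENNReal.ofReal_lt_top
  -- domination `‖m[χ](Φ_t z)‖ ≤ Cχ/2 · (1 + g z)`
  have hFm : Measurable fun z => empiricalMomentumField (Φ.flow t z) χ :=
    (measurable_empiricalMomentumField' hχ).comp (Φ.measurable_flow t)
  refine (((integrable_const (Cχ / 2)).add (hgi.const_mul (Cχ / 2)))).mono' hFm.aestronglyMeasurable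
    (ae_of_all _ fun z => ?_)
  have hsq : ‖empiricalMomentumField (Φ.flow t z) χ‖ ^ 2 ≤ Cχ ^ 2 * g z :=
    norm_empiricalMomentumField_sq_le hCχ hCχ0 (Φ.flow t z)
  -- from `a² ≤ C² g`, `a, C, g ≥ 0`: `a ≤ C (1 + g)/2` since `C√g ≤ C(1+g)/2`
  have ha' : 0 ≤ ‖empiricalMomentumField (Φ.flow t z) χ‖ := norm_nonneg _
  simp only [Pi.add_apply]
  nlinarith [hsq, hg0 z, sq_nonneg (‖empiricalMomentumField (Φ.flow t z) χ‖ - Cχ / 2 * (1 + g z)),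
    mul_nonneg hCχ0 (hg0 z), sq_nonneg (1 - g z), mul_nonneg (mul_nonneg hCχ0 hCχ0) (sq_nonneg (1 - g z))]

/-- **`S → C`: the packing-guarded conjunct implies the crux `MeanEulerLimit`** (the crux is a necessary
condition of the sub-problem statement). -/
theorem meanEulerLimit_of_hydrodynamicLimit (h : _root_.HydrodynamicLimit) :
    TwoTimePressureGerm.MeanEulerLimit := by
  obtain ⟨η₀, hη₀, H⟩ := h
  refine ⟨η₀, hη₀, fun a₀ θ₀ u₀ ha hθ hu ha0 hθ0 => ?_⟩
  obtain ⟨σ₀, hσ₀, H1⟩ := H a₀ θ₀ u₀ ha hθ hu ha0 hθ0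
  refine ⟨min σ₀ (1 / 2), lt_min hσ₀ one_half_pos, ?_⟩
  intro σ hσ hσ' T ρ θ u hE hband Φ h0 t ht χ hχ
  have hσ1 : σ < σ₀ := hσ'.trans_le (min_le_left _ _)
  have hσ2 : σ ≤ 1 / 2 := (hσ'.trans_le (min_le_right _ _)).le
  have HL : TendstoHydroFieldsAt (fun N => localGibbsLaw σ a₀ u₀ θ₀ N (Φ N)) Φ ρ u θ t :=
    H1 σ hσ hσ1 T ρ θ u hE hband Φ h0 t ht
  obtain ⟨hD, hM, hEn⟩ :=
    tendsto_means_flow_of_tendstoHydroFieldsAt_of_solution ha hθ hu ha0 hθ0 hσ2 Φ hE ht HL hχ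
  refine ⟨hD, ?_, hEn⟩
  -- vector form of the momentum limit
  have hρc : Continuous (ρ t) := (hE.smooth_density.isSmooth_slice ht).continuous
  have huc : Continuous (u t) := (hE.smooth_velocity.isSmooth_slice ht).continuous
  have hi : Integrable (fun x => (χ x * ρ t x) • u t x) (volume : Measure T3) :=
    integrable_of_continuous_T3 ((hχ.mul hρc).smul huc)
  refine tendsto_V3_of_coord fun j => ?_
  have e1 : (∫ x, (χ x * ρ t x) • u t x) j = ∫ x, χ x * ρ t x * u t x j := by
    rw [integral_apply_V3 hi j]
    simp only [PiLp.smul_apply, smul_eq_mul]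
  rw [e1]
  refine (hM j).congr' (Eventually.of_forall fun N => ?_)
  exact (integral_apply_V3 (integrable_momentumField_flow ha hθ hu ha0 hθ0 hσ2 N (Φ N) t hχ) j).symm


/-- **`C → X_mean`: the crux implies the mean hydrodynamic limit in the band** (item stmt-AtomisticToContinuum-11927,
`ResponseRigidity.MeanHydroLimitInBand`: smooth test functions, momentum componentwise). -/
theorem meanHydroLimitInBand_of_meanEulerLimit (h : TwoTimePressureGerm.MeanEulerLimit) :
    ResponseRigidity.MeanHydroLimitInBand := by
  obtain ⟨η₀, hη₀, H⟩ := h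
  refine ⟨η₀, hη₀, fun a₀ θ₀ u₀ ha hθ hu ha0 hθ0 => ?_⟩
  obtain ⟨σ₀, hσ₀, H1⟩ := H a₀ θ₀ u₀ ha hθ hu ha0 hθ0
  refine ⟨min σ₀ (1 / 2), lt_min hσ₀ one_half_pos, ?_⟩
  intro σ hσ hσ' T ρ θ u hE hband Φ h0 t ht χ hχ
  have hσ1 : σ < σ₀ := hσ'.trans_le (min_le_left _ _)
  have hσ2 : σ ≤ 1 / 2 := (hσ'.trans_le (min_le_right _ _)).le
  obtain ⟨hD, hM, hEn⟩ := H1 σ hσ hσ1 T ρ θ u hE hband Φ h0 t ht χ hχ.continuous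
  refine ⟨hD, fun j => ?_, hEn⟩
  have hρc : Continuous (ρ t) := (hE.smooth_density.isSmooth_slice ht).continuous
  have huc : Continuous (u t) := (hE.smooth_velocity.isSmooth_slice ht).continuous
  have hi : Integrable (fun x => (χ x * ρ t x) • u t x) (volume : Measure T3) :=
    integrable_of_continuous_T3 ((hχ.continuous.mul hρc).smul huc)
  have e1 : (∫ x, (χ x * ρ t x) • u t x) j = ∫ x, χ x * ρ t x * u t x j := by
    rw [integral_apply_V3 hi j]
    simp only [PiLp.smul_apply, smul_eq_mul]
  have hj := ((PiLp.continuous_apply 2 (fun _ : Fin 3 => ℝ) j).tendsto _).comp hM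
  rw [Function.comp_def, e1] at hj
  refine hj.congr' (Eventually.of_forall fun N => ?_)
  exact integral_apply_V3 (integrable_momentumField_flow ha hθ hu ha0 hθ0 hσ2 N (Φ N) t hχ.continuous) j

/-- **`C → S`: the crux implies the packing-guarded conjunct**, through the LANDED mean closure
(`RestartPrinciple.hydrodynamicLimit_of_meanHydroLimitInBand`: mean ⇒ probability by entropy saturation). -/
theorem hydrodynamicLimit_of_meanEulerLimit (h : TwoTimePressureGerm.MeanEulerLimit) : _root_.HydrodynamicLimit :=
  Theorems.RestartPrinciple.hydrodynamicLimit_of_meanHydroLimitInBand (meanHydroLimitInBand_of_meanEulerLimit h)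

/-- **RESTATES-SUMMIT: the rank-4 crux `MeanEulerLimit` is EQUIVALENT to the sub-problem conjunct** modulo landed
theorems. -/
theorem meanEulerLimit_iff_hydrodynamicLimit : TwoTimePressureGerm.MeanEulerLimit ↔ _root_.HydrodynamicLimit :=
  ⟨hydrodynamicLimit_of_meanEulerLimit, meanEulerLimit_of_hydrodynamicLimit⟩

/-- Consequence for the route's deciding theorem: `TiltSubGaussian` is idle — `MeanEulerLimit` alone closes. -/
theorem closes_of_meanEulerLimit_alone (hM : TwoTimePressureGerm.MeanEulerLimit) : _root_.HydrodynamicLimit :=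
  hydrodynamicLimit_of_meanEulerLimit hM

end Summit.AtomisticToContinuum.HydrodynamicLimit.Cruxes.MeanEulerLimit.Vetting

end
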